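import Literature.NumberTheory.EllipticCurves.PAdicLFunctionQuadraticTwistBirchProofs
import HarnessLib

/-!
# Birch's lemma for the newforms of `E` and `E^{(d)}` WITH ITS PERIOD CONSTANT: `[x]⁺_{f_A} = c · Σ_b χ_d(b) [x + b/d]⁺_{f_W}`
# and `c² · d · (Ω⁺_{f_A})² = (Ω⁺_{f_W})²` (PROOFS ONLY: no `def`, no named fact)

Companion of `PAdicLFunctionQuadraticTwistBirchProofs` (cell bsd-2adic, seat conv-1 GEN 13, road «hKan-mult», μ-twin). The tree's
symbol-level Birch lemma `CuspFormTwistRatPlusSymbol.exists_rat_forall_ratPlusSymbol_charTwist_eq` (Mazur–Tate–Teitelbaum §I.8 /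
Shimura Prop. 3.64) carries, besides the ONE rational constant `c` with `[r]⁺_{f_χ} = c · Σ_u χ(u)[r + u/m]⁺_f`, the period identity
`c · Ω⁺_{f_χ} · g(χ) = Ω⁺_f` as soon as one twisted sum is nonzero. GEN 12's `exists_ratPlusSymbol_twist_eq_sum` transported the
first clause to the pair of newforms `(f_W, f_A)` of `E` and `A = E^{(d)}` (`d > 0`, `d ≡ 1 (mod 4)` squarefree, `(d, N_E) = 1`) and
dropped the second. This file keeps it, SQUARED so that the sign of the quadratic Gauss sum plays no role:
`g(χ_d)² = χ_d(−1)·d = d` (Mathlib `gaussSum_sq`; `χ_d` even since `d > 0`; at `d = 1` directly), hence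

* **`exists_ratPlusSymbol_twist_eq_sum_and_sq`** — `∃ c ∈ ℚ`, `∀ x, [x]⁺_{f_A} = c · Σ_{b mod d} χ_d(b)[x + b/d]⁺_{f_W}`, AND
  `(∃ x, [x]⁺_{f_A} ≠ 0) → c² · d · (Ω⁺_{f_A})² = (Ω⁺_{f_W})²` (real numbers; `Ω⁺ = plusPeriod`, all real components).

With V. Pal's `√d · Ω(A) = Ω(W)` (Néron periods, `ũ = 1`; tree theorem
`Pal2012.sqrt_mul_realPeriodRat_eq_of_twist_of_pos_of_squarefree`) this pins the `2`-adic size of the rational normalisers in the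
Kida transport of the `μ`-invariant (`|c · ϖ_A| = |ϖ_W|`, `ϖ·Ω = Ω⁺_f`).

References: B. Mazur, J. Tate, J. Teitelbaum, Invent. Math. 84 (1986), §I.8 [MazurTateTeitelbaum1986Invent]; G. Shimura,
*Introduction to the arithmetic theory of automorphic functions* (1971), Prop. 3.64 [Shimura1971]; K. Ireland, M. Rosen, *A classical
introduction to modern number theory*, Prop. 8.2.2 (g² = χ(−1)p) [IrelandRosen1990].
-/

noncomputable section

open scoped MatrixGroups ModularForm NumberTheorySymbols

open CongruenceSubgroup WeierstrassCurve Literature.NumberTheory.EllipticCurves.ModularForms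

namespace Literature.NumberTheory.EllipticCurves

section BirchPeriod

variable (W : WeierstrassCurve ℚ) [W.IsElliptic] {d : ℤ} {A : WeierstrassCurve ℚ} [A.IsElliptic]
  [NeZero (W.conductorNorm ℤ)] [NeZero (A.conductorNorm ℤ)] [NeZero d.natAbs]
  {fW : CuspForm (Gamma0 (W.conductorNorm ℤ)) 2} {fA : CuspForm (Gamma0 (A.conductorNorm ℤ)) 2}

omit [W.IsElliptic] [A.IsElliptic] [NeZero (W.conductorNorm ℤ)] [NeZero (A.conductorNorm ℤ)] [NeZero d.natAbs] in
/-- **`g(χ)² = N` for an EVEN QUADRATIC PRIMITIVE Dirichlet character mod `N`** (any `N ≥ 1`, composite allowed): the Fourier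
transform of `χ` is `g(χ)·χ` (`IsPrimitive.fourierTransform_eq_inv_mul_gaussSum`, `χ⁻¹ = χ`, `χ(−k) = χ(k)`), and Fourier
inversion `𝓕𝓕χ = N·χ(−·)` (`ZMod.dft_dft`) evaluated at `1` gives `g(χ)² = N`. (Mathlib's `gaussSum_sq` needs a FIELD `ZMod N`.)
[cite: IrelandRosen1990, Prop. 8.2.2] -/
theorem gaussSum_stdAddChar_sq_of_isQuadratic_of_even {N : ℕ} [NeZero N] {χ : DirichletCharacter ℂ N}
    (hχ : χ.IsPrimitive) (hq : MulChar.IsQuadratic χ) (he : χ.Even) :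
    gaussSum χ (ZMod.stdAddChar (N := N)) ^ 2 = (N : ℂ) := by
  have he' : ∀ k : ZMod N, χ (-k) = χ k := fun k ↦ by
    rw [← neg_one_mul, map_mul, he, one_mul]
  have h1 : ZMod.dft (⇑χ) = fun k ↦ χ k * gaussSum χ (ZMod.stdAddChar (N := N)) := by
    funext k
    rw [hχ.fourierTransform_eq_inv_mul_gaussSum, hq.inv, he']
  have h2 := ZMod.dft_dft (⇑χ)
  rw [h1, ZMod.dft_mul_const, h1] at h2
  have h3 := congrFun h2 1
  simp only [he', map_one, one_mul, smul_eq_mul, mul_one] at h3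
  rw [sq]
  exact h3

omit [W.IsElliptic] [A.IsElliptic] [NeZero (W.conductorNorm ℤ)] [NeZero (A.conductorNorm ℤ)] in
/-- **`g(χ_d)² = d`** for the complex avatar of the Jacobi character mod `m = |d|`, `d > 0`, `d ≡ 1 (mod 4)` squarefree (primitive,
quadratic, even). [cite: IrelandRosen1990, Prop. 8.2.2] -/
theorem gaussSum_jacobi_sq_eq (hd : 0 < d) (hd4 : d % 4 = 1) (hsq : Squarefree d)
    {χ : MulChar (ZMod d.natAbs) ℤ} (hχ : ∀ a : ZMod d.natAbs, χ a = J((a.val : ℤ) | d.natAbs)) :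
    gaussSum (χ.ringHomComp (Int.castRingHom ℂ)) (ZMod.stdAddChar (N := d.natAbs)) ^ 2 = (d.natAbs : ℂ) := by
  have hodd : Odd d.natAbs := Int.natAbs_odd.mpr (Int.odd_iff.mpr (by omega))
  have hsq' : Squarefree d.natAbs := Int.squarefree_natAbs.mpr hsq
  have hm4 : d.natAbs % 4 = 1 := by omega
  obtain ⟨hq, hprim⟩ := mulChar_jacobi_complex_isQuadratic_isPrimitive hχ hodd hsq'
  have heven : DirichletCharacter.Even (χ.ringHomComp (Int.castRingHom ℂ)) := by
    show (χ.ringHomComp (Int.castRingHom ℂ)) (-1) = 1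
    rw [MulChar.ringHomComp_apply, mulChar_jacobi_apply_neg_one hχ hm4, map_one]
  exact gaussSum_stdAddChar_sq_of_isQuadratic_of_even hprim hq heven

/-- **Birch's lemma for `(f_W, f_A)` WITH the period constant.** For `d > 0`, `d ≡ 1 (mod 4)` squarefree, `(d, N_E) = 1`, `A` a model
of `E^{(d)}` and the newforms `f_W`, `f_A`: there is ONE `c ∈ ℚ` with `[x]⁺_{f_A} = c · Σ_{b mod d} χ_d(b) · [x + b/d]⁺_{f_W}` for
every `x`, and, as soon as some `[x]⁺_{f_A} ≠ 0`, `c² · d · (Ω⁺_{f_A})² = (Ω⁺_{f_W})²` — the tree's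
`exists_rat_forall_ratPlusSymbol_charTwist_eq` (`c·Ω⁺_{f_χ}·g(χ) = Ω⁺_f`) transported along `f_A = charTwist N_A f_W` and squared with
`g(χ_d)² = d`. [cite: MazurTateTeitelbaum1986Invent, §I.8] [cite: Shimura1971, Prop. 3.64] -/
theorem exists_ratPlusSymbol_twist_eq_sum_and_sq (hmod : exists_isNewformOf) (hd : 0 < d) (hd4 : d % 4 = 1)
    (hsq : Squarefree d) (hcop : IsCoprime d (W.conductorNorm ℤ : ℤ)) {C : VariableChange ℚ}
    (hA : C • W.quadraticTwist (d : ℚ) = A) (hfW : IsNewformOf W fW) (hfA : IsNewformOf A fA)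
    {χ : MulChar (ZMod d.natAbs) ℤ} (hχ : ∀ a : ZMod d.natAbs, χ a = J((a.val : ℤ) | d.natAbs)) :
    ∃ c : ℚ, (∀ x : ℚ, ratPlusSymbol fA x =
        c * ∑ b : ZMod d.natAbs, (χ.ringHomComp (Int.castRingHom ℚ)) b * ratPlusSymbol fW (x + (b.val : ℚ) / d.natAbs)) ∧
      ((∃ x : ℚ, ratPlusSymbol fA x ≠ 0) → (c : ℝ) ^ 2 * (d : ℝ) * plusPeriod fA ^ 2 = plusPeriod fW ^ 2) := by
  have hmd : (d.natAbs : ℤ) = d := Int.natAbs_of_nonneg hd.le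
  have hodd : Odd d.natAbs := Int.natAbs_odd.mpr (Int.odd_iff.mpr (by omega))
  have hsq' : Squarefree d.natAbs := Int.squarefree_natAbs.mpr hsq
  have hm4 : d.natAbs % 4 = 1 := by omega
  obtain ⟨hq, hprim⟩ := mulChar_jacobi_complex_isQuadratic_isPrimitive hχ hodd hsq'
  have heven : DirichletCharacter.Even (χ.ringHomComp (Int.castRingHom ℂ)) := by
    show (χ.ringHomComp (Int.castRingHom ℂ)) (-1) = 1
    rw [MulChar.ringHomComp_apply, mulChar_jacobi_apply_neg_one hχ hm4, map_one]
  have hg2 := gaussSum_jacobi_sq_eq hd hd4 hsq hχ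
  have hNA := conductorNorm_twist_eq W hmod hd4 hsq hcop hA
  have hN : W.conductorNorm ℤ ∣ A.conductorNorm ℤ := ⟨d.natAbs ^ 2, hNA⟩
  have hm : d.natAbs ^ 2 ∣ A.conductorNorm ℤ := ⟨W.conductorNorm ℤ, by rw [hNA, mul_comm]⟩
  have hFA := isNewformOf_twist_eq_charTwist W hd4 hsq hcop hA hfW hfA hχ hq hprim hN hm
  subst hFA
  obtain ⟨c, hc, hper⟩ := exists_rat_forall_ratPlusSymbol_charTwist_eq (A.conductorNorm ℤ) hN hm hq heven hprim
    hfW.1 hfW.coeffField_eq_bot hfA.1 hfA.coeffField_eq_bot (fun u ↦ J((u.val : ℤ) | d.natAbs))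
    (fun u ↦ by rw [MulChar.ringHomComp_apply, hχ, eq_intCast])
  have hsum : ∀ x : ℚ, ∑ b : ZMod d.natAbs, (χ.ringHomComp (Int.castRingHom ℚ)) b *
      ratPlusSymbol fW (x + (b.val : ℚ) / d.natAbs) =
      ∑ u : ZMod d.natAbs, (J((u.val : ℤ) | d.natAbs) : ℚ) * ratPlusSymbol fW (x + twistShift u) := by
    intro x
    refine Finset.sum_congr rfl fun b _ ↦ ?_
    rw [MulChar.ringHomComp_apply, hχ, eq_intCast]
    rfl
  refine ⟨c, fun x ↦ by rw [hc x, hsum x], fun ⟨x, hx⟩ ↦ ?_⟩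
  have hS : ∃ r : ℚ, ∑ u : ZMod d.natAbs, (J((u.val : ℤ) | d.natAbs) : ℚ) * ratPlusSymbol fW (r + twistShift u) ≠ 0 := by
    refine ⟨x, fun h0 ↦ hx ?_⟩
    rw [hc x, h0, mul_zero]
  have hP := hper hS
  -- square and use `g² = d`
  have hsqP := congrArg (fun z : ℂ ↦ z ^ 2) hP
  rw [mul_pow, mul_pow, hg2] at hsqP
  have hdZ : ((d.natAbs : ℤ) : ℂ) = (d : ℂ) := congrArg (Int.cast : ℤ → ℂ) hmd
  have hdC : ((d.natAbs : ℕ) : ℂ) = (d : ℂ) := by rw [← hdZ, Int.cast_natCast]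
  rw [hdC] at hsqP
  apply Complex.ofReal_injective
  push_cast
  linear_combination hsqP

end BirchPeriod

end Literature.NumberTheory.EllipticCurves

end
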